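import Summits.Ventures.HodgeRepro2.T6A2WeilPush
import Summits.Ventures.HodgeRepro2.T6A2GysinProofs

/-!
# T6A2WeilSituation — the A2 situation (S, B, B × B, S × B and the route's morphisms) on the host Weil cohomology

Cell pub-hodge-repro2, Tier 6 (README §10), seat t6-p2 (A2 host side). Given a smooth projective `B` with an
«addition» `m : B ⊗ B ⟶ B` (for the corner product: the group law of the host `AbelianVariety`, `μ[B.X]`), a
smooth projective surface `S` with `f : S ⟶ B`, generic points and the smoothness of the pairwise products
(the host's named fact `IsSmoothProjective.tensor`), the four spaces `S, B, B ⊗ B, S ⊗ B` and the morphisms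
`f, pr₁, pr₂, m, φ := (pr₂, m), pr_B, f × id, h := m ∘ (f × id)` form an `A2Situation` of
`cycleTheoryOfWeil` — the four defining identities of T6A2Gysin (`pr₁ ∘ φ = pr₂`, `pr₂ ∘ φ = m`,
`pr₂ ∘ (f × id) = pr_B`, `h = m ∘ (f × id)`) hold in the cartesian monoidal category of schemes
(`lift_fst`, `lift_snd`, `tensorHom_snd`). With it, every object of sub-claim A2 (`z = f_* 1`, `a ⊗ b`,
`a ⋆ b`, `y`, `ζ`, `γ`, `T_γ`) and every theorem of T6A2GysinProofs is available on the host.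
No `sorry`; standard axioms.
§8(d): uses an L-value-free non-vanishing device: NO.
-/

noncomputable section

namespace Summit.Ventures.HodgeRepro2.T6.WeilInst

open HostAPI.Carriers.AlgebraicGeometry.Motives CategoryTheory Opposite MonoidalCategory
  CartesianMonoidalCategory
open Summit.Ventures.HodgeRepro2.T6.A2Gysin

universe u

variable {k : Type u} [Field k] (W : WeilCohomology k ℚ)

/-- THE HOST DATA OF THE A2 SITUATION: `B` with its addition, the surface `S → B`, the product facts. -/
structure SituationData (k : Type u) [Field k] where
  /-- the corner product `B` (smooth projective, with its dimension) -/
  B : SPVar k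
  /-- the addition `m : B × B → B` (the group law of the abelian variety) -/
  m : B.X ⊗ B.X ⟶ B.X
  /-- the surface `S` -/
  S : SPVar k
  /-- the morphism `f : S → B` of sub-claim A1 -/
  f : S.X ⟶ B.X
  /-- `B × B` is smooth projective of dimension `2 dim B` (the host's `IsSmoothProjective.tensor`) -/
  smoothBB : IsSmoothProjective (B.n + B.n) (B.X ⊗ B.X)
  /-- `S × B` is smooth projective (the host's `IsSmoothProjective.tensor`) -/
  smoothSB : IsSmoothProjective (S.n + B.n) (S.X ⊗ B.X)

namespace SituationData

variable (D : SituationData k)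

/-- `B × B` as a smooth projective variety -/
def BB : SPVar k := ⟨D.B.X ⊗ D.B.X, D.B.n + D.B.n, D.smoothBB⟩

/-- `S × B` as a smooth projective variety -/
def SB : SPVar k := ⟨D.S.X ⊗ D.B.X, D.S.n + D.B.n, D.smoothSB⟩

/-- the index type of the four spaces (`Fin 4` lifted to the universe of `k`) -/
abbrev Idx : Type u := ULift.{u} (Fin 4)

/-- the four spaces of the situation, indexed by `Idx`: `S, B, B × B, S × B` -/
def spaces : Idx.{u} → SPVar k := fun i => ![D.S, D.B, D.BB, D.SB] i.down

/-- the generic points -/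
abbrev HasGens : Prop := ∀ i, HasGen (D.spaces i)

/-- the smoothness of all pairwise products (the host's `IsSmoothProjective.tensor`, 16 instances) -/
abbrev ProductsSmooth : Prop :=
  ∀ i j, IsSmoothProjective ((D.spaces i).n + (D.spaces j).n) ((D.spaces i).X ⊗ (D.spaces j).X)

variable (hgen : D.HasGens) (hten : D.ProductsSmooth)

/-- A2's cycle theory on the host, for the four spaces of the situation -/
def cycleTheory : CycleTheory.{u} := cycleTheoryOfWeil W D.spaces hgen hten

/-- THE A2 SITUATION ON THE HOST. -/
def situation : A2Situation (D.cycleTheory W hgen hten) where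
  S := ⟨0⟩
  B := ⟨1⟩
  BB := ⟨2⟩
  SB := ⟨3⟩
  f := D.f
  pr1 := fst D.B.X D.B.X
  pr2 := snd D.B.X D.B.X
  m := D.m
  phi := lift (snd D.B.X D.B.X) D.m
  prB := snd D.S.X D.B.X
  fid := D.f ⊗ₘ 𝟙 D.B.X
  h := (D.f ⊗ₘ 𝟙 D.B.X) ≫ D.m
  pr1_phi := lift_fst _ _
  pr2_phi := lift_snd _ _
  pr2_fid := by
    change (D.f ⊗ₘ 𝟙 D.B.X) ≫ snd D.B.X D.B.X = snd D.S.X D.B.X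
    rw [tensorHom_snd, Category.comp_id]
  h_def := rfl

/-- the seven displayed facts hold for the situation's cycle theory -/
theorem cycleTheory_hypotheses :
    (D.cycleTheory W hgen hten).Functoriality ∧ (D.cycleTheory W hgen hten).BredonCupProduct ∧
      (D.cycleTheory W hgen hten).BredonCapProduct ∧ (D.cycleTheory W hgen hten).AugmentationNatural ∧
      (D.cycleTheory W hgen hten).PoincareDuality ∧ (D.cycleTheory W hgen hten).FultonProperPushForward ∧
      (D.cycleTheory W hgen hten).FultonCycleClassRingHom :=
  cycleTheoryOfWeil_hypotheses W D.spaces hgen hten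

/-- Poincaré duality for the situation -/
theorem poincareDuality : (D.cycleTheory W hgen hten).PoincareDuality :=
  (D.cycleTheory_hypotheses W hgen hten).2.2.2.2.1

/-- THE CLASS `z = f_* 1 ∈ H^{2 codim S}(B)` of the surface on the host: `ofDeg` of the host's class. -/
def z : EvenRing W D.B := (D.situation W hgen hten).z (D.poincareDuality W hgen hten)

/-- `z` is algebraic (TIER4 (S1), `A2Situation.z_mem_Alg` on the host). -/
theorem z_mem_alg : D.z W hgen hten ∈ (D.cycleTheory W hgen hten).Alg ⟨1⟩ :=
  (D.situation W hgen hten).z_mem_Alg (D.poincareDuality W hgen hten)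
    (D.cycleTheory_hypotheses W hgen hten).2.2.2.2.2.1 (D.cycleTheory_hypotheses W hgen hten).2.2.2.2.2.2

end SituationData

end Summit.Ventures.HodgeRepro2.T6.WeilInst

end
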